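import Summits.QuantumFields.YangMills.Theorems.AtomicCalibrationRPairCutoff
import Summits.QuantumFields.YangMills.Theorems.AtomicCalibrationRLocalFlatness
import Summits.QuantumFields.YangMills.Theorems.AtomicCalibrationRWhitneyBookkeeping
import Summits.QuantumFields.YangMills.Theorems.AtomicCalibrationRFlatLeibniz

/-!
# AtomicCalibrationR (stmt-QuantumFields-28169), E2 `stub_offDiagonalWhitney` — clause (v) for the band pieces of construction (T)
# (construction (T) of the E2 helper note, evidence #19 on 28169; prover w4 g22, free hands)

The per-piece derivative estimate of `WhitneyPkg` (v) for a band piece `P = G · b`, `b = (pairCut (k+1) − pairCut k) · g`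
(`g` any `C^∞` factor, e.g. a grid bump), `G` a real `C^∞` function dominated order-by-order by the off-diagonal test function `F`
(e.g. `Re F`, `Im F`, `AtomicCalibrationRRealImag`):

* `norm_iteratedFDeriv_le_schwartzNorm_of_mem_closedBall` — decay on a ball in the always-positive form
  `‖D^K F w‖ ≤ 2^M (1+R)^{k'} schwartzNorm M F / (1+‖z‖)^{k'}` for `w ∈ closedBall z R`;
* `norm_iteratedFDeriv_bandPiece_le` — for `m < K` and a rate `R ≥ 2^{k+2}` of `b` at `z`:
  `‖D^m (G·b)(z)‖ ≤ (2^M 2^{k'} ‖F‖_M / (1+‖z‖)^{k'}) · (1 + 2^{−k} R)^m · (2^{−k})^K · R^m`, `M = max k' K`.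
  Near a pair (`‖z_l − z_{l'}‖ ≤ 2·2^{−k}`) this is `LocalFlatness` + `FlatLeibniz`; otherwise the cut-off difference vanishes near
  `z` and so does every derivative of the piece.

With `R = 2C'n²2^{k+1} + 4An/h_k` (`AtomicCalibrationRBandBump`) and `h_k ≍ 2^{−k}/Λ` the right-hand side is
`M_{k,c} / ρ^m` with `ρ = 2h_k` and `M_{k,c}` carrying the flatness gain `2^{−kK}` and the decay `(1+‖z‖)^{−k'}` — the inputs of
the mass sum (vi).  No stub/crux/rung/summit is closed; nothing here touches Yang–Mills; the YM mass gap is NOT proved. [folklore]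
-/

set_option autoImplicit false

noncomputable section

open scoped BigOperators ContDiff Nat Topology
open Set Metric Filter
open Summit.QuantumFields.YangMills.Cruxes.AtomicCalibrationR.PairCutoff (pairCut contDiff_pairCut pairCut_eq_one_of_far)
open Summit.QuantumFields.YangMills.Cruxes.AtomicCalibrationR.FlatLeibniz (norm_iteratedFDeriv_mul_le_of_flat')
open Literature.MathematicalPhysics.QuantumLattice (schwartzNorm schwartzNorm_nonneg)
open Literature.MathematicalPhysics.AQFT (IsOffDiagonal)

namespace Summit.QuantumFields.YangMills.Cruxes.AtomicCalibrationR.BandPiece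

/-! ## Decay on balls, positive form -/

section Decay

variable {X : Type*} [NormedAddCommGroup X] [NormedSpace ℝ X]

/-- **Decay on a ball, positive form**: for `w ∈ closedBall z R`, `R ≥ 0`:
`‖D^K F(w)‖ ≤ 2^M (1+R)^{k'} schwartzNorm M F / (1+‖z‖)^{k'}`, `M = max k' K` (from `1 + ‖z‖ ≤ (1+R)(1+‖w‖)`). -/
theorem norm_iteratedFDeriv_le_schwartzNorm_of_mem_closedBall (F : SchwartzMap X ℂ) (k K : ℕ) {z w : X} {R : ℝ}
    (hR : 0 ≤ R) (hw : w ∈ closedBall z R) :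
    ‖iteratedFDeriv ℝ K F w‖ ≤ 2 ^ max k K * (1 + R) ^ k * schwartzNorm (max k K) F / (1 + ‖z‖) ^ k := by
  have h1 := Summit.QuantumFields.YangMills.Cruxes.AtomicCalibrationR.WhitneyBookkeeping.norm_iteratedFDeriv_le_schwartzNorm_div
    F k K w
  refine h1.trans ?_
  have hS : 0 ≤ schwartzNorm (max k K) F := schwartzNorm_nonneg _ _
  have hzw : 1 + ‖z‖ ≤ (1 + R) * (1 + ‖w‖) := by
    rw [mem_closedBall, dist_eq_norm] at hw
    have : ‖z‖ ≤ ‖w‖ + R := by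
      have := norm_sub_norm_le z w; rw [norm_sub_rev] at hw; linarith
    nlinarith [norm_nonneg w, norm_nonneg z]
  have hpow : (1 + ‖z‖) ^ k ≤ (1 + R) ^ k * (1 + ‖w‖) ^ k := by
    rw [← mul_pow]; exact pow_le_pow_left₀ (by positivity) hzw k
  rw [div_le_div_iff₀ (by positivity) (by positivity)]
  calc 2 ^ max k K * schwartzNorm (max k K) F * (1 + ‖z‖) ^ k
      ≤ 2 ^ max k K * schwartzNorm (max k K) F * ((1 + R) ^ k * (1 + ‖w‖) ^ k) :=
        mul_le_mul_of_nonneg_left hpow (by positivity)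
    _ = 2 ^ max k K * (1 + R) ^ k * schwartzNorm (max k K) F * (1 + ‖w‖) ^ k := by ring

end Decay

/-! ## Clause (v) for band pieces -/

variable {n : ℕ}

/-- The far region of level `k` (all pairs `> 2·2^{−k}` apart) is open. -/
theorem isOpen_far (n k : ℕ) :
    IsOpen {w : Fin n → EuclideanSpace ℝ (Fin 4) | ∀ l l' : Fin n, l ≠ l' → 2 * (2 : ℝ)⁻¹ ^ k < ‖w l - w l'‖} := by
  have : {w : Fin n → EuclideanSpace ℝ (Fin 4) | ∀ l l' : Fin n, l ≠ l' → 2 * (2 : ℝ)⁻¹ ^ k < ‖w l - w l'‖} =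
      ⋂ l : Fin n, ⋂ l' : Fin n, {w | l ≠ l' → 2 * (2 : ℝ)⁻¹ ^ k < ‖w l - w l'‖} := by
    ext w; simp only [mem_setOf_eq, mem_iInter]
  rw [this]
  refine isOpen_iInter_of_finite fun l => isOpen_iInter_of_finite fun l' => ?_
  by_cases hll' : l = l'
  · have : {w : Fin n → EuclideanSpace ℝ (Fin 4) | l ≠ l' → 2 * (2 : ℝ)⁻¹ ^ k < ‖w l - w l'‖} = univ := by
      ext w; simp [hll']
    rw [this]; exact isOpen_univ
  · have : {w : Fin n → EuclideanSpace ℝ (Fin 4) | l ≠ l' → 2 * (2 : ℝ)⁻¹ ^ k < ‖w l - w l'‖} =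
        {w | 2 * (2 : ℝ)⁻¹ ^ k < ‖w l - w l'‖} := by
      ext w; simp [hll']
    rw [this]
    exact isOpen_lt continuous_const (by fun_prop)

/-- In the far region of level `k` the telescoping factor of level `k+1` vanishes identically. -/
theorem pairCut_succ_sub_eq_zero_of_far {k : ℕ} {w : Fin n → EuclideanSpace ℝ (Fin 4)}
    (hw : ∀ l l' : Fin n, l ≠ l' → 2 * (2 : ℝ)⁻¹ ^ k < ‖w l - w l'‖) : pairCut n (k + 1) w - pairCut n k w = 0 := by
  have h1 : pairCut n k w = 1 := pairCut_eq_one_of_far fun l l' hll' => (hw l l' hll').le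
  have h2 : pairCut n (k + 1) w = 1 := by
    refine pairCut_eq_one_of_far fun l l' hll' => le_trans ?_ (hw l l' hll').le
    rw [pow_succ]
    have : (0 : ℝ) ≤ (2 : ℝ)⁻¹ ^ k := by positivity
    nlinarith
  rw [h1, h2, sub_self]

/-- **Clause (v) for band pieces.**  `F ∈ ⁰𝒮`, `G` real `C^∞` with `‖D^j G‖ ≤ ‖D^j F‖` pointwise (e.g. `Re F`, `Im F`), `g` any
`C^∞` factor, `b = (pairCut (k+1) − pairCut k)·g` with rate `‖D^i b(z)‖ ≤ R^i` (`i ≤ m`) at the point `z`, `R ≥ 2^{k+2}`, `m < K`: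
`‖D^m (G b)(z)‖ ≤ (2^M 2^{k'} ‖F‖_M/(1+‖z‖)^{k'}) (1 + 2^{−k}R)^m (2^{−k})^K R^m`, `M = max k' K`. [folklore] -/
theorem norm_iteratedFDeriv_bandPiece_le (F : SchwartzMap (Fin n → EuclideanSpace ℝ (Fin 4)) ℂ) (hF : IsOffDiagonal F)
    {G : (Fin n → EuclideanSpace ℝ (Fin 4)) → ℝ} (hG : ContDiff ℝ ∞ G)
    (hGF : ∀ (j : ℕ) (w : Fin n → EuclideanSpace ℝ (Fin 4)), ‖iteratedFDeriv ℝ j G w‖ ≤ ‖iteratedFDeriv ℝ j F w‖)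
    {g : (Fin n → EuclideanSpace ℝ (Fin 4)) → ℝ} (hg : ContDiff ℝ ∞ g) (k : ℕ) {K m k' : ℕ} (hmK : m < K) {R : ℝ}
    (hR : (2 : ℝ) ^ (k + 2) ≤ R) (z : Fin n → EuclideanSpace ℝ (Fin 4))
    (hb : ∀ i : ℕ, i ≤ m → ‖iteratedFDeriv ℝ i (fun w => (pairCut n (k + 1) w - pairCut n k w) * g w) z‖ ≤ R ^ i) :
    ‖iteratedFDeriv ℝ m (fun w => G w * ((pairCut n (k + 1) w - pairCut n k w) * g w)) z‖ ≤
      (2 ^ max k' K * 2 ^ k' * schwartzNorm (max k' K) F / (1 + ‖z‖) ^ k') *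
        (1 + (2 : ℝ)⁻¹ ^ k * R) ^ m * ((2 : ℝ)⁻¹ ^ k) ^ K * R ^ m := by
  set r : ℝ := (2 : ℝ)⁻¹ ^ k with hr
  set P : ℝ := 2 ^ max k' K * 2 ^ k' * schwartzNorm (max k' K) F / (1 + ‖z‖) ^ k' with hP
  have hr0 : 0 < r := by positivity
  have hRpos : 0 < R := lt_of_lt_of_le (by positivity) hR
  have hP0 : 0 ≤ P := by have := schwartzNorm_nonneg (max k' K) F; positivity
  have hRHS0 : 0 ≤ P * (1 + r * R) ^ m * r ^ K * R ^ m := by positivity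
  have hb_smooth : ContDiff ℝ ∞ (fun w => (pairCut n (k + 1) w - pairCut n k w) * g w) :=
    ((contDiff_pairCut n (k + 1)).sub (contDiff_pairCut n k)).mul hg
  by_cases hnear : ∃ l l' : Fin n, l ≠ l' ∧ ‖z l - z l'‖ ≤ 2 * (2 : ℝ)⁻¹ ^ k
  · -- near pair: flatness + Leibniz
    obtain ⟨l, l', hll', hd⟩ := hnear
    -- local bound `B` on the ball of radius `‖z_l − z_l'‖/2 ≤ r ≤ 1`
    set ρ' : ℝ := ‖z l - z l'‖ / 2 with hρ'
    have hρ'0 : 0 ≤ ρ' := by positivity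
    have hρ'r : ρ' ≤ r := by rw [hρ', hr]; linarith
    have hr1 : r ≤ 1 := by rw [hr]; exact pow_le_one₀ (by norm_num) (by norm_num)
    have hB : ∀ w ∈ closedBall z ρ', ‖iteratedFDeriv ℝ K F w‖ ≤ P := by
      intro w hw
      refine (norm_iteratedFDeriv_le_schwartzNorm_of_mem_closedBall F k' K hρ'0 hw).trans ?_
      rw [hP]
      have hS : 0 ≤ schwartzNorm (max k' K) F := schwartzNorm_nonneg _ _
      refine div_le_div_of_nonneg_right ?_ (by positivity)
      refine mul_le_mul_of_nonneg_right (mul_le_mul_of_nonneg_left ?_ (by positivity)) hS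
      exact pow_le_pow_left₀ (by positivity) (by linarith) k'
    -- flatness of `F`, hence of `G`, at `z`: `‖D^j G z‖ ≤ P r^{K-j}` for `j ≤ m`
    have hFb : ∀ j : ℕ, j ≤ m → ‖iteratedFDeriv ℝ j G z‖ ≤ P * r ^ (K - j) := by
      intro j hj
      have hjK : j < K := lt_of_le_of_lt hj hmK
      have h1 := hF.norm_iteratedFDeriv_le_of_pair_local hll' hjK z hB
      refine (hGF j z).trans (h1.trans ?_)
      have hfac : (1 : ℝ) ≤ (K - j - 1)! := by exact_mod_cast Nat.one_le_iff_ne_zero.2 (Nat.factorial_ne_zero _)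
      calc P * (‖z l - z l'‖ / 2) ^ (K - j) / (K - j - 1)! ≤ P * (‖z l - z l'‖ / 2) ^ (K - j) :=
            div_le_self (by positivity) hfac
        _ ≤ P * r ^ (K - j) := mul_le_mul_of_nonneg_left (pow_le_pow_left₀ hρ'0 hρ'r _) hP0
    -- rates of `b` in the `Q s^{-i}` form with `Q = 1`, `s = R⁻¹`
    have hΦb : ∀ i : ℕ, i ≤ m → ‖iteratedFDeriv ℝ i (fun w => (pairCut n (k + 1) w - pairCut n k w) * g w) z‖ ≤
        1 * R⁻¹⁻¹ ^ i := by
      intro i hi; rw [inv_inv, one_mul]; exact hb i hi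
    have hsr : R⁻¹ ≤ r := by
      rw [hr, inv_pow, inv_le_inv₀ hRpos (by positivity)]
      calc (2 : ℝ) ^ k ≤ 2 ^ (k + 2) := pow_le_pow_right₀ (by norm_num) (by omega)
        _ ≤ R := hR
    have h := norm_iteratedFDeriv_mul_le_of_flat' (A := ℝ) hG hb_smooth hmK.le hP0 zero_le_one (inv_pos.2 hRpos) hsr z hFb hΦb
    refine h.trans (le_of_eq ?_)
    rw [div_eq_mul_inv, ← inv_pow, inv_inv, div_eq_mul_inv, inv_inv]
    ring
  · -- far from every pair: the piece vanishes near `z`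
    push Not at hnear
    have hfar : ∀ l l' : Fin n, l ≠ l' → 2 * (2 : ℝ)⁻¹ ^ k < ‖z l - z l'‖ := fun l l' hll' => hnear l l' hll'
    have hev : (fun w => G w * ((pairCut n (k + 1) w - pairCut n k w) * g w)) =ᶠ[𝓝 z]
        fun _ => (0 : ℝ) := by
      filter_upwards [(isOpen_far n k).mem_nhds hfar] with w hw
      rw [pairCut_succ_sub_eq_zero_of_far hw, zero_mul, mul_zero]
    rw [(hev.iteratedFDeriv ℝ m).eq_of_nhds, iteratedFDeriv_fun_zero, Pi.zero_apply, norm_zero]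
    exact hRHS0

end Summit.QuantumFields.YangMills.Cruxes.AtomicCalibrationR.BandPiece

end
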